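import Mathlib
import HarnessLib
import Summits.Langlands.Langlands.Theses.HeptagonalTower
import Literature.NumberTheory.EllipticCurves.KatoTwistedFiniteness

/-!
# Birth skeleton (BC3) for crux stmt-Langlands-16988
`Summit.Langlands.Langlands.Theses.HeptagonalTower.KatoRankZeroSeven` — line `birth`

Route `route-Langlands-HeptagonalTower` (crux #4, rank 4).  The crux ("Kato's step"): assuming
`NonvanishingSevenTwists` (no even primitive twist `L(X₀(15), χ, 1)`, `cond χ = 7^{k+1}`, vanishes),
for every totally real number field `K` embedding in some `ℚ(ζ_{7^{n+1}})` every `K`-rational point of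
`X₀(15)` — Legendre model `y² = x(x+16)(x+25)`, inlined as the base change to `K` of
`⟨0, 41, 0, 400, 0⟩ : WeierstrassCurve ℚ` — has finite order.

The skeleton is the cut named by the crux's own `why it might fail` ("turning 'finite χ-Selmer for one
p' into 'no point of infinite order over K' needs the χ-isotypic Kummer injection — routine,
unvendored") and by the route's TWO-LAYER PLAN ("KatoRankZeroSeven splits as KatoTwistedFinite (vendor
Kato Cor. 14.3 for twists of the level-15 newform) → IsotypicDescent (finite χ-Selmer for all χ ∈ X(K)
⇒ E(K) torsion)"), with the trivial character split off because its input is different (rank zero of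
15A1 over `ℚ`, not a twisted `L`-value).  Everything is phrased on Kato's `χ`-part
`M^(χ) = {x ∈ M ; I_χ · x = 0}` (`Literature.NumberTheory.EllipticCurves.chiPart`) of the Mordell–Weil
group `M = X₀(15)(ℚ(ζ_{7^{n+1}}))` with its Galois action `σ ↦ Point.map σ`, and on Dirichlet characters
mod `7^{n+1}` read as characters of `Gal(ℚ(ζ_{7^{n+1}})/ℚ) ≅ (ℤ/7^{n+1})ˣ`
(`Literature.NumberTheory.EllipticCurves.cyclotomicCharacterOf`) — verbatim the vocabulary of the tree's
named fact `Literature.NumberTheory.EllipticCurves.kato_finite_chiPart_of_twistedLValue_ne_zero`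
(Kato 2004, Astérisque 295, Cor. 14.3 (2)), so that STUB 2 is literally "apply the vendored fact".
(`CyclotomicField ((7 : ℕ+) ^ (n + 1)) ℚ` is the crux's spelling; it elaborates to modulus
`↑7 ^ (n + 1) : ℕ`, and the same term indexes the Dirichlet characters below.)

* `stub_trivialPart` — **rank zero over `ℚ` (the `χ = 1` branch).**  For every `n`, the `χ`-part of
  `M = X₀(15)(ℚ(ζ_{7^{n+1}}))` for the trivial character mod `7^{n+1}` is finite.  Since
  `cyclotomicCharacterOf 1 ≡ 1`, `I_1` is the augmentation ideal and `M^(1) = M^{G}` (`G = Gal`), i.e.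
  (Galois descent on coordinates, `ℚ(ζ)/ℚ` Galois) the image of `X₀(15)(ℚ)`: the eight points
  `O, (0,0), (−16,0), (−25,0), (20,±180), (−20,±20)`.  Inputs: the named fact
  `Literature.NumberTheory.Automorphic.Thorne2019_prop4` (`|E₁(ℚ)| = 8`, Cremona 15A1) transported along
  the PROVED Legendre bridge `Thorne2019.variableChange_E₁ : legendreChange • E₁ = X0FifteenLegendre`
  (`X0FifteenLegendre` is definitionally `⟨0, 41, 0, 400, 0⟩`); alternatively `kato_finite_of_L_one_ne_zero`
  with `L(X₀(15),1) = Ω/8 ≠ 0` (PAdicBSD.lean).  Size M.  NOT covered by `NonvanishingSevenTwists`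
  (conductor `≥ 7` there) — which is why it is its own stub.
* `stub_katoTwisted` — **Kato's twisted rank-zero theorem for `X₀(15)` on the even non-trivial
  branches.**  Assuming `NonvanishingSevenTwists`: for every `n` and every Dirichlet character `χ` mod
  `7^{n+1}` with `χ ≠ 1` and `χ(−1) = 1`, the `χ`-part `M^(χ)` is finite.  Chain: `χ` has conductor
  `7^{k+1}`, `0 ≤ k ≤ n`; its primitive character `χ₀` is even and `χ n = χ₀ n` for EVERY `n : ℕ` (both
  vanish exactly on `7ℕ` because `χ ≠ 1 ⇔ cond χ ≠ 1`), so `twistedLSeries f χ = twistedLSeries f χ₀`;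
  modularity of `X₀(15)` (named fact `exists_isNewformOf`, BCDT: `f₁₅` with `cuspCoeff f₁₅ n = aₙ(W)`,
  the second conjunct of `IsNewformOf`) rewrites the hypothesis' `LSeries (χ · aₙ(W))` into
  `twistedLSeries f₁₅ χ₀`; an entire continuation exists (`exists_differentiable_eq_twistedLSeries_holds`,
  PROVED) and is non-zero at `1` by `NonvanishingSevenTwists k χ₀`; then Kato Cor. 14.3 (2)
  (`kato_finite_chiPart_of_twistedLValue_ne_zero`, `m = 7^{n+1}`, `m % 4 ≠ 2`) gives `Finite M^(χ)`.
  Size M (character bookkeeping `DirichletCharacter ℂ (7^(k+1))` ↔ `(↑7)^(n+1)`, `primitiveCharacter`,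
  `changeLevel`); conditional on the two named facts (Kato, BCDT) exactly as the route intends.
* `stub_isotypicDescent` — **isotypic descent from `ℚ(ζ_{7^{n+1}})` to its totally real subfields.**  For
  every `n`: if `M^(χ)` is finite for EVERY even Dirichlet character `χ` mod `7^{n+1}` (trivial one
  included), then for every totally real number field `K` with a ring embedding `ι : K →+* ℚ(ζ_{7^{n+1}})`
  every `K`-point `P` of `X₀(15)` has finite order.  Unconditional algebra: `Q := Point.map ι P ∈ M`
  (`Point.map` is an injective homomorphism, `map_injective`, so `Q` has infinite order if `P` does);
  `σ₋₁ = autEquivPow⁻¹(−1)` (complex conjugation) fixes `ι(K)` pointwise because every complex embedding of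
  the totally real `K` is real and `φ ∘ σ₋₁ = conj ∘ φ` for any `φ : ℚ(ζ) →+* ℂ`, hence `σ₋₁ · Q = Q`
  (`map_map`); with `N = |G| = 6·7ⁿ` and `a_ψ = Σ_g ψ(g⁻¹) g` (coefficients in `ℤ[ζ_N]`, or the rational
  orbit sums `N·e_[ψ] ∈ ℤ[G]`), orthogonality gives `N·Q = Σ_ψ a_ψ Q` and `I_ψ · a_ψ = 0` EXACTLY, so some
  `a_ψ Q` is an element of infinite order of the `ψ`-part; for ODD `ψ` (`ψ(σ₋₁) = −1`) one has
  `(1 + σ₋₁) ∈ I_ψ` and `(1 − σ₋₁) Q = 0`, whence `2 · a_ψ Q = 0` — so the infinite-order element sits in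
  an EVEN `ψ`-part, contradicting the hypothesis.  Mathlib inputs: `DirichletCharacter` orthogonality
  (`DirichletCharacter.sum_char_inv_mul_char_eq`), `IsCyclotomicExtension.autEquivPow`,
  `NumberField.IsTotallyReal`, `ComplexEmbedding.IsReal`, `WeierstrassCurve.Affine.Point.map_injective /
  map_map`.  Size M–L (a few hundred lines; the `TODO(general K)` of KatoTwistedFiniteness.lean).
* `KatoRankZeroSeven_of` — the composition, kernel-checked (no `sorry`): given `hNV`, `K`, `⟨n, ι⟩`, `P`,
  apply STUB 3 at level `n`; its finiteness hypothesis at an even `χ` is STUB 1 if `χ = 1` (`subst`) and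
  STUB 2 (fed `hNV`) otherwise.  Concludes the route decl BY NAME.

None of the three stubs gives the crux or the summit cheaply (BC3 probes, see the line card
`Lines/birth.md`: `Stub → KatoRankZeroSeven` and `Stub → Langlands` by
`first | exact? | simpa [Stub] | (unfold Stub; simpa) | aesop` FAIL, 6/6), and none restates the crux:
STUB 3 replaces the analytic hypothesis by the algebraic finiteness it actually consumes, STUBS 1–2 live on
the cyclotomic field, not on `K`.

Disproof used: none on file for this crux (`ledger crux ls stmt-Langlands-16988`: no workfiles — no
`Disproof.lean`, no `Negative/` lemmas, no crux ideas — 2026-08-17).  Grounder notes honoured (g74-1,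
g74-3 on the item): the Kato fact's spelling is matched verbatim (STUB 2), the trivial character is NOT
claimed from `NonvanishingSevenTwists` (STUB 1), the descent glue is isolated as the one unvendored piece
(STUB 3), and no auxiliary prime / image condition is introduced (none survives in the vendored Cor. 14.3 (2)).

Shape (for `ledger skeleton check`): stubs `theorem stub_<name> : <signature> := by sorry` stated over
tree declarations only (`chiPart`, `cyclotomicCharacterOf`, the route's `NonvanishingSevenTwists`, Mathlib
`WeierstrassCurve.Affine.Point.map`, `CyclotomicField`, `DirichletCharacter`, `IsOfFinAddOrder`,
`NumberField.IsTotallyReal`); `_Goal.stub_<name> : Prop := type_of% @stub_<name>` names each statement;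
`KatoRankZeroSeven_of (h₁ : _Goal.stub_trivialPart) (h₂ : _Goal.stub_katoTwisted)
(h₃ : _Goal.stub_isotypicDescent) : KatoRankZeroSeven` is proved without `sorry`.  `open scoped Classical`
as in the route file (the group law on `Point` needs `DecidableEq` on the field).
-/

set_option linter.dupNamespace false
set_option linter.unusedVariables false

noncomputable section

namespace Summit.Langlands.Langlands.Cruxes.KatoRankZeroSeven.Birth

open Summit.Langlands.Langlands.Theses.HeptagonalTower
open WeierstrassCurve WeierstrassCurve.Affine
open scoped Classical

/-! ## 1. The three stubs -/

/-- **STUB 1 — rank zero over `ℚ`, in Kato's `χ`-part form for the trivial character.**  For every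
`n`, the `χ`-part of `X₀(15)(ℚ(ζ_{7^{n+1}}))` (Legendre model `⟨0, 41, 0, 400, 0⟩`, Galois action
`σ ↦ Point.map σ`) for the TRIVIAL Dirichlet character mod `7^{n+1}` is finite — i.e. the
`Gal(ℚ(ζ_{7^{n+1}})/ℚ)`-invariant points (the image of `X₀(15)(ℚ)`, eight points) form a finite group.
Inputs: `Thorne2019_prop4` (named fact, `|E₁(ℚ)| = 8`) + the proved Legendre bridge
`Thorne2019.variableChange_E₁` + Galois descent on coordinates.  Size M.
[cite: Thorne2019, Prop. 4] [cite: Kato2004Asterisque, §14 Thm. 14.2 (p. 235)] -/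
theorem stub_trivialPart :
    ∀ n : ℕ, Finite (Literature.NumberTheory.EllipticCurves.chiPart
      (fun σ : CyclotomicField ((7 : ℕ+) ^ (n + 1)) ℚ ≃ₐ[ℚ] CyclotomicField ((7 : ℕ+) ^ (n + 1)) ℚ =>
        WeierstrassCurve.Affine.Point.map
          (W' := ({ a₁ := 0, a₂ := 41, a₃ := 0, a₄ := 400, a₆ := 0 } : WeierstrassCurve ℚ).toAffine)
          (σ : CyclotomicField ((7 : ℕ+) ^ (n + 1)) ℚ →ₐ[ℚ] CyclotomicField ((7 : ℕ+) ^ (n + 1)) ℚ))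
      (fun σ => (Literature.NumberTheory.EllipticCurves.cyclotomicCharacterOf
        (1 : DirichletCharacter ℂ ((7 : ℕ+) ^ (n + 1))) σ : ℂ))) := by
  sorry

/-- **STUB 2 — Kato's twisted rank-zero theorem for `X₀(15)` on the even non-trivial branches.**
Assuming `NonvanishingSevenTwists`: for every `n` and every Dirichlet character `χ` mod `7^{n+1}` with
`χ ≠ 1` and `χ(−1) = 1`, the `χ`-part of `X₀(15)(ℚ(ζ_{7^{n+1}}))` is finite.  Proof plan: pass to the
primitive character `χ₀` of `χ` (conductor `7^{k+1}`, even, same values on `ℕ` since both vanish exactly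
on `7ℕ`), rewrite `LSeries (χ₀ · aₙ(W))` as `twistedLSeries f₁₅ χ₀ = twistedLSeries f₁₅ χ` through
`IsNewformOf W f₁₅` (named fact `exists_isNewformOf`, BCDT), take the entire continuation
(`exists_differentiable_eq_twistedLSeries_holds`), get `L(1) ≠ 0` from `NonvanishingSevenTwists k χ₀`,
and apply the named fact `kato_finite_chiPart_of_twistedLValue_ne_zero` with `m = 7^{n+1}`
(`m % 4 ≠ 2`).  Size M; conditional on Kato Cor. 14.3 (2) and BCDT, as the route intends.
[cite: Kato2004Asterisque, Cor. 14.3 (2) (p. 235)] [cite: BreuilConradDiamondTaylor2001, Thm. A] -/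
theorem stub_katoTwisted :
    Summit.Langlands.Langlands.Theses.HeptagonalTower.NonvanishingSevenTwists →
      ∀ (n : ℕ) (χ : DirichletCharacter ℂ ((7 : ℕ+) ^ (n + 1))), χ ≠ 1 → χ (-1) = 1 →
        Finite (Literature.NumberTheory.EllipticCurves.chiPart
          (fun σ : CyclotomicField ((7 : ℕ+) ^ (n + 1)) ℚ ≃ₐ[ℚ] CyclotomicField ((7 : ℕ+) ^ (n + 1)) ℚ =>
            WeierstrassCurve.Affine.Point.map
              (W' := ({ a₁ := 0, a₂ := 41, a₃ := 0, a₄ := 400, a₆ := 0 } : WeierstrassCurve ℚ).toAffine)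
              (σ : CyclotomicField ((7 : ℕ+) ^ (n + 1)) ℚ →ₐ[ℚ] CyclotomicField ((7 : ℕ+) ^ (n + 1)) ℚ))
          (fun σ => (Literature.NumberTheory.EllipticCurves.cyclotomicCharacterOf χ σ : ℂ))) := by
  sorry

/-- **STUB 3 — isotypic descent from `ℚ(ζ_{7^{n+1}})` to its totally real subfields** (the
`χ`-isotypic injection named in the crux's `why it might fail`; `TODO(general K)` of
KatoTwistedFiniteness.lean).  For every `n`: if the `χ`-part of `M = X₀(15)(ℚ(ζ_{7^{n+1}}))` is finite
for every EVEN Dirichlet character `χ` mod `7^{n+1}` (trivial character included), then for every totally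
real number field `K` admitting a ring embedding `ι : K →+* ℚ(ζ_{7^{n+1}})` every `K`-point of `X₀(15)`
has finite order.  Unconditional: `Point.map ι` is injective (infinite order is preserved); `σ₋₁` fixes
`ι(K)` pointwise (total reality), so `Q = Point.map ι P` is `σ₋₁`-fixed; with `a_ψ = Σ_g ψ(g⁻¹) g`,
`|G|·Q = Σ_ψ a_ψ Q`, `I_ψ a_ψ = 0`, and `2 a_ψ Q = 0` for odd `ψ` — so an infinite-order `Q` produces an
infinite even `ψ`-part.  Size M–L. [folklore] -/
theorem stub_isotypicDescent :
    ∀ n : ℕ, (∀ χ : DirichletCharacter ℂ ((7 : ℕ+) ^ (n + 1)), χ (-1) = 1 →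
        Finite (Literature.NumberTheory.EllipticCurves.chiPart
          (fun σ : CyclotomicField ((7 : ℕ+) ^ (n + 1)) ℚ ≃ₐ[ℚ] CyclotomicField ((7 : ℕ+) ^ (n + 1)) ℚ =>
            WeierstrassCurve.Affine.Point.map
              (W' := ({ a₁ := 0, a₂ := 41, a₃ := 0, a₄ := 400, a₆ := 0 } : WeierstrassCurve ℚ).toAffine)
              (σ : CyclotomicField ((7 : ℕ+) ^ (n + 1)) ℚ →ₐ[ℚ] CyclotomicField ((7 : ℕ+) ^ (n + 1)) ℚ))
          (fun σ => (Literature.NumberTheory.EllipticCurves.cyclotomicCharacterOf χ σ : ℂ)))) →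
      ∀ (K : Type) [Field K] [NumberField K], NumberField.IsTotallyReal K →
        Nonempty (K →+* CyclotomicField ((7 : ℕ+) ^ (n + 1)) ℚ) →
          ∀ P : (({ a₁ := 0, a₂ := 41, a₃ := 0, a₄ := 400, a₆ := 0 } : WeierstrassCurve ℚ).baseChange K).toAffine.Point,
            IsOfFinAddOrder P := by
  sorry

/-! ## 2. The stub statements as named `Prop`s (literally their types) -/

namespace _Goal

/-- The statement of `stub_trivialPart`, as a named `Prop` (literally its type). [folklore] -/
def stub_trivialPart : Prop :=
  type_of% @Summit.Langlands.Langlands.Cruxes.KatoRankZeroSeven.Birth.stub_trivialPart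

/-- The statement of `stub_katoTwisted`, as a named `Prop` (literally its type). [folklore] -/
def stub_katoTwisted : Prop :=
  type_of% @Summit.Langlands.Langlands.Cruxes.KatoRankZeroSeven.Birth.stub_katoTwisted

/-- The statement of `stub_isotypicDescent`, as a named `Prop` (literally its type). [folklore] -/
def stub_isotypicDescent : Prop :=
  type_of% @Summit.Langlands.Langlands.Cruxes.KatoRankZeroSeven.Birth.stub_isotypicDescent

end _Goal

/-! ## 3. The composition (kernel-checked, no `sorry`) -/

/-- **`KatoRankZeroSeven` from the three stubs.**  Given `hNV : NonvanishingSevenTwists`, a totally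
real `K` with `⟨n, ι⟩ : ∃ n, Nonempty (K →+* ℚ(ζ_{7^{n+1}}))` and a point `P`, STUB 3 at level `n`
reduces the goal to the finiteness of every even `χ`-part, which is STUB 1 for `χ = 1` and STUB 2 (fed
`hNV`) for `χ ≠ 1`.  Hypotheses are, by name, the statements of the three stubs; the conclusion is the
route decl `Summit.Langlands.Langlands.Theses.HeptagonalTower.KatoRankZeroSeven`. [folklore] -/
theorem KatoRankZeroSeven_of (h₁ : _Goal.stub_trivialPart) (h₂ : _Goal.stub_katoTwisted)
    (h₃ : _Goal.stub_isotypicDescent) :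
    Summit.Langlands.Langlands.Theses.HeptagonalTower.KatoRankZeroSeven := by
  have hT : type_of% @stub_trivialPart := h₁
  have hK : type_of% @stub_katoTwisted := h₂
  have hD : type_of% @stub_isotypicDescent := h₃
  intro hNV K _ _ hK' hemb P
  obtain ⟨n, hn⟩ := hemb
  refine hD n (fun χ hχ => ?_) K hK' hn P
  by_cases h1 : χ = 1
  · subst h1
    exact hT n
  · exact hK hNV n χ h1 hχ

/-- By-name sanity check: the three stubs feed the composition as they stand. -/
example : Summit.Langlands.Langlands.Theses.HeptagonalTower.KatoRankZeroSeven :=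
  KatoRankZeroSeven_of stub_trivialPart stub_katoTwisted stub_isotypicDescent

end Summit.Langlands.Langlands.Cruxes.KatoRankZeroSeven.Birth

end
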